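import Summits.Parity.GeneralizedHardyLittlewood.Theses.LeeYangFibres
import Summits.Parity.GeneralizedHardyLittlewood.Theorems.LeeYangFibresAbsoluteUpgradeDefs
import Summits.Parity.GeneralizedHardyLittlewood.Theorems.LeeYangFibresAbsoluteUpgradeWalshClipping
import Summits.Parity.GeneralizedHardyLittlewood.Theorems.LeeYangFibresAbsoluteUpgradeRoughAnatomy
import Summits.Parity.GeneralizedHardyLittlewood.Theorems.LeeYangFibresAbsoluteUpgradeCellsToDimOne
import Summits.Parity.GeneralizedHardyLittlewood.Theorems.LeeYangFibresAbsoluteUpgradeClipCells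
import Summits.Parity.GeneralizedHardyLittlewood.Theorems.LeeYangFibresAbsoluteUpgradeSinglesDecay
import Summits.Parity.GeneralizedHardyLittlewood.Theorems.LeeYangFibresAbsoluteUpgradeNlcReduction
import Summits.Parity.GeneralizedHardyLittlewood.Theorems.LeeYangFibresAbsoluteUpgradeTarget
import HarnessLib

/-!
# Crux `AbsoluteUpgrade` (stmt-Parity-14116) — line `nlc-cells-absolute-clip`

`AbsoluteUpgrade := RelativeDimOne → DimOne` (route `LeeYangFibres`, sub-problem
`GeneralizedHardyLittlewood`).  Skeleton of the line built from the crux idea card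
`Cruxes/AbsoluteUpgrade/Ideas/nlc-cells-absolute-clip.md` (ideator 1, triage r1-1/2/3: pass ×3) with the
three sharpenings the panel asked for: (1) the NLC slack carries ONE factor of the singular mass
`β_∞ ∏_p β_p / N` (so it is DimOne-level, not finer); (2) the `u`-range of every `u`-uniform statement is
decoupled from `log log N` and is exactly what the line uses, `u ≤ A · log log log N`; (3) the `t ≥ 3`
clipping is a separate finite-dimensional stub on the FULL corner lattice `{1,2,3}^t` (adjacent instances
alone are refuted by `Θ = 4·𝟙[σ₁ = σ₂ = σ₃]`).

## The line in one paragraph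

Write the joint rough `Ω`-cells of a `d = 1` system as `C_j = Θ(σ(j)) M_j + E_j` (the route's cell parity
law, crux 3, here needed uniformly for `2 ≤ u ≤ A log₃ N`: `stub_cellParityLawLog3`).  The independent
anatomy model `M_j = β_∞ ∏β_p ∏_i A_{j_i}(N)/N` is a PRODUCT over the forms, hence EXTREMAL (slack `0`) for
the negative lattice condition `C_{j∨j'} C_{j∧j'} ≤ C_j C_{j'}`; so NLC at the prime corner with an
absolute, mass-scaled slack (`stub_cellNLC`, the line's one non-sieve input, replacing the zero-locus
hypothesis `FibreHyperbolicity`) clips the MIXED parity amplitudes to the law's own absolute accuracy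
(`stub_walshClipping`; the `t = 2` case is the kernel-checked `nlc_clips_mixed_amplitude` below:
`|θ₁₂ − θ₁θ₂| ≤ 8δ + η`).  The SINGLE amplitudes are sieve-visible (`stub_singlesDecay`: fundamental lemma
in dimension `t` + Bombieri–Vinogradov for the Liouville function along one form, both PROVED engines in
the tree) with RELATIVE accuracy `e^{-cu}`, which beats the residual factor
`sup ∏_p β_p ≤ C(t,L)(log log N)^{t-1}` (tree theorem `stub_singularProduct_le_loglog_pow`, p86331) at the
slowly divergent roughness `u(N) ≍ ((t-1)/c) log log log N` — the only place where the factor that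
DEFINES the crux is paid.  Normalising by the corner anatomy (`stub_roughAnatomy`) and choosing `u(N)`
gives the prime corner cell ABSOLUTELY (`stub_clipCells` ⟹ `PrimeCellsAbsolute`), and partial summation
with the de la Vallée Poussin rate (tree: `ChebyshevThetaDeLaValleePoussin_holds`) gives `DimOne`
(`stub_cellsToDimOne`), hence the crux (`AbsoluteUpgrade_of`, pure logic, no sorry outside `stub_*`).

## Where the crux stands (lead seat c4, 2026-08-16T19:40Z): held on the target stmt-Parity-0819

Four lead seats (0, 1/c2/c3/c4 on this line, c1 on `dip-margin-rate-exchange`) have landed every provable stub of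
every line; both mechanism reductions are UNGUARDED and the node both deliver is the target, now read BY NAME
against the home declaration of the shared item stmt-Parity-0819 in
`Theorems/LeeYangFibresAbsoluteUpgradeTarget.lean` (p121721): `(AbsoluteUpgrade ∧ RelativeDimOne) ↔
DicksonFibration.DimOne`, `AbsoluteUpgrade ↔ (DicksonFibration.DimOne ∨ ¬RelativeDimOne)`,
`target_of_nlcInputs : CellParityLawLog3 → CellNLC → DicksonFibration.DimOne`, and the discharge one-liner
`absoluteUpgrade_of_target : DicksonFibration.DimOne → AbsoluteUpgrade`.  The two remaining `sorry`s below are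
conjectures of at least target strength; the line is complete as a reduction and the crux is filed
`blocked-on: stmt-Parity-0819` (dossier `Lines/nlc-cells-absolute-clip-lead-c4.md`).

## Disproof used (Cruxes/AbsoluteUpgrade/Disproof.lean, cdisprove cycle 1, 2026-08-16T09:30Z)

* `not_upgradeSchema` / `not_rateSchema` (landed as `Theorems/AbsoluteUpgrade/Negative/AbsoluteUpgradeSchema`,
  p94184): the parametric upgrade `∀ S, RelShape S → AbsShape S` is FALSE, i.e. no proof may treat
  `RelativeDimOne` as a black box.  Honoured: this line never upgrades `RelativeDimOne`; it proves `DimOne`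
  from the cells of `vonMangoldtSum` itself (`stub_clipCells`, `stub_cellsToDimOne`), and `RelativeDimOne`
  enters only as the GUARD of the two conjectural inputs (`stub_cellParityLawLog3`, `stub_cellNLC`), where
  it is free (it is the crux's hypothesis) and strictly stronger than `¬UnboundedSiegelZeros`
  (tree: `noSiegelZeros_of_relativeDimOne`, p89962) — triage r1-3's guard rule.
* `absoluteUpgrade_iff_highMass` (tree, p77305) locates the content on systems of mass `≥ M N`; the NLC
  stub is typed with exactly that mass hypothesis (`η₀ N ≤ β_∞ ∏β_p`), low-mass systems being law-only.
* No `-- Targets` kill and no landed `Negative/` lemma concerns a statement of this line (the disproof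
  attacks line `Sketch`); `ledger negatives --problem Parity` (ConvMomentLevelOne, TupleElliott,
  RectangleChowla) — none is an instance of a stub below.

## Stubs (7, registered) and composition

conjectural inputs (HL-strength, guarded): `stub_cellParityLawLog3`, `stub_cellNLC`;
provable now: `stub_singlesDecay` (L/XL), `stub_walshClipping` (M; `t = 2` proved here),
`stub_roughAnatomy` (M), `stub_clipCells` (L), `stub_cellsToDimOne` (L);
`AbsoluteUpgrade_of : AbsoluteUpgrade` (proved modulo the stubs).
-/

noncomputable section

open scoped BigOperators Classical
open Finset Filter

namespace Summit.Parity.GeneralizedHardyLittlewood.Cruxes.AbsoluteUpgrade.NlcCellsAbsoluteClip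

open Literature.NumberTheory.Sieve
open Summit.Parity.GeneralizedHardyLittlewood.Theses.LeeYangFibres

/-! ## Vocabulary

All objects (`jointCell`, `roughTuples`, `roughCell`, `walshForm`, `modelCell`, `IsCorner`) and statement types
(`CellParityLawLog3`, `CellNLC`, `SinglesDecay`, `WalshClipping`, `RoughAnatomy`, `PrimeCellsAbsolute`) of this line
live in the LANDED vocabulary file `Theorems/LeeYangFibresAbsoluteUpgradeDefs.lean` (p96024, same namespace), together
with the proved sanity lemma `cellParityLaw_of_log3 : CellParityLawLog3 → CellParityLaw`. -/

/-! ## Stubs (registered; `sorry` only here)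

After lead seat c2 (2026-08-16T17:45Z): the only `sorry`s left are the two CONJECTURAL guarded inputs
`stub_cellParityLawLog3` and `stub_cellNLC`; every provable stub is landed and wired by name.

Lead seat c3 (2026-08-16T19:10Z): unchanged stub set; the node the line delivers is now identified with
the target — `primeCellsAbsolute_iff_dimOne : PrimeCellsAbsolute ↔ DimOne` and
`absoluteUpgrade_iff_cells : AbsoluteUpgrade ↔ (RelativeDimOne → PrimeCellsAbsolute)` (LANDED p120846,
`Theorems/LeeYangFibresAbsoluteUpgradeCellsOfDimOne.lean`, registered sub-goal
`primeCellsAbsolute_of_dimOne`), see the block after the composition. -/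

/-- **Stub 1 (conjectural input, crux-3 strength; guarded).** Under uniform relative Hardy–Littlewood the
cell parity law holds along slowly divergent roughness.  (Unguarded it is crux 3 with `u`-uniformity; the
guard `RelativeDimOne` is the crux's own hypothesis and kills every resonance of relative size `≥ ε`,
cf. `noSiegelZeros_of_relativeDimOne`.)  Candidate for promotion to a route item if the line is built.
[cite: BombieriAsymptoticSieve1976] [cite: FriedlanderIwaniecPisa1978] [conjecture] -/
theorem stub_cellParityLawLog3 : RelativeDimOne → CellParityLawLog3 := by
  sorry

/-- **Stub 2 (THE LEVER; conjectural, HL-strength; guarded).** Under uniform relative Hardy–Littlewood the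
joint rough cells satisfy the negative lattice condition at the prime corner with mass-scaled absolute
slack (`CellNLC`).  Candidate for promotion to a route item (new crux) if the line is built.
[cite: BorceaBranden2009] [cite: arXiv:1210.3231] [conjecture] -/
theorem stub_cellNLC : RelativeDimOne → CellNLC := by
  sorry

/-- **Stub 3 (provable now, L/XL).** The single-form parity marginals of the rough tuples are sieve-visible
with rate `e^{-cu}` (Fundamental Lemma in dimension `t` + Bombieri–Vinogradov for `λ` along one form +
`λ`-PNT in a fixed progression; see `SinglesDecay`). [cite: FriedlanderIwaniecOpera2010, Cor. 6.10] -/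
theorem stub_singlesDecay : SinglesDecay :=
  -- LANDED (lead seat c2): `Theorems/LeeYangFibresAbsoluteUpgradeSinglesDecay.lean` (+ one-scale file
  -- `…SinglesDecayScale.lean` p119468; engines = seat 1's helper files 1–9 …SinglesDecay{Seq,AP,Local,Weights,Remainder,Dict,Cases,Prep,Thresholds})
  Summit.Parity.GeneralizedHardyLittlewood.Theorems.AbsoluteUpgrade.stub_singlesDecay

/-- **Stub 4 (provable now, M; `t = 2` proved below as `nlc_clips_mixed_amplitude`).** The corner
negative-lattice inequalities clip the Walsh form at the prime corner linearly in the slacks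
(see `WalshClipping`). [folklore] -/
theorem stub_walshClipping : WalshClipping :=
  -- LANDED (p97202, all `t`, explicit `c₀ = 1`, `C = 2^t (8·2^t + 2)`):
  -- `Theorems/LeeYangFibresAbsoluteUpgradeWalshClipping.lean` (+ `…WalshClippingAux.lean`, p96692)
  Summit.Parity.GeneralizedHardyLittlewood.Theorems.AbsoluteUpgrade.stub_walshClipping

/-- **Stub 5 (provable now, M, parity-free).** Corner cells `≍ N/log N` and `Φ(N, N^{1/u}) ≫ u N/log N`
uniformly for `4 ≤ u ≤ A log₃ N` (see `RoughAnatomy`). [cite: Tenenbaum2015, III.6] -/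
theorem stub_roughAnatomy : RoughAnatomy :=
  -- LANDED (p97352, wave 1): `Theorems/LeeYangFibresAbsoluteUpgradeRoughAnatomy.lean`
  Summit.Parity.GeneralizedHardyLittlewood.Theorems.AbsoluteUpgrade.stub_roughAnatomy

/-- **Stub 6 (provable now, L) — the clipping assembly.**  Given `t, L, ε`: take `c` from `SinglesDecay`
(at `(t,L)` and at `(1,1)` for the parity balance `ρ_N(u)` of the rough integers), `A := (t-1)/c + 1`,
`u(N) := ⌈((t-1) log₃ N + log(C'/ε))/c⌉ ∈ [4, A log₃ N]`; low-mass systems (`β_∞∏β_p < η₀(ε,t) N`) are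
law-only (`|Θ| ≤ 2^{t+1}`, `A_1 ≤ 2N/log N`); on high-mass systems normalise `c_j := C_j/(M m_j)` on the
corner (`m_j = ∏ A_{j_i}/N ≥ (c_an/log N)^t` by `RoughAnatomy`), so the law gives
`δ ≤ ε_law N/(M c_an^t)`, NLC gives `η_norm ≤ η (N/M)/c_an^{2t}` (`m_{j∨j'} m_{j∧j'} = m_j m_{j'}`), the
marginal Walsh identity `Σ_j σ(j_i) C_j = M â^t (θ_i + Σ_{S ≠ {i}} θ_S ρ^{|S Δ {i}|}) + Σ_j σ(j_i)E_j`
(`â = Φ(N,N^{1/u})/N ≥ c_an u/log N`, `Ω(ψ_k(n)) ≤ u` automatically once `N^{1/u} > 2L`) and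
`SinglesDecay` give `τ`, and `WalshClipping` bounds `M m_𝟙 |Θ(𝟙) − 1|` by
`C_W (ε_law (2/c_an)^t + η 2^t/c_an^{2t}) N/log^t N + 2 C(t,L)(log log N)^{t-1} N (2/log N)^t C_W (C e^{-c u(N)}/c_an^t + …)`,
absolute by the choice of `u(N)` (tree: `stub_singularProduct_le_loglog_pow`). [folklore] -/
theorem stub_clipCells :
    CellParityLawLog3 → CellNLC → SinglesDecay → WalshClipping → RoughAnatomy → PrimeCellsAbsolute :=
  -- LANDED (p117105, lead seat c2, wave 1): `Theorems/LeeYangFibresAbsoluteUpgradeClipCells.lean`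
  -- (parameter choice `u(N) ≍ log₃ N` on top of `highMass_bound` / `clipCells_lowMass`, …ClipCellsScale p102842)
  Summit.Parity.GeneralizedHardyLittlewood.Theorems.AbsoluteUpgrade.stub_clipCells

/-- **Stub 7 (provable now, L) — partial summation with a rate.**  Absolute prime cells give `DimOne`:
drop prime powers and primes `≤ N^{1/u} ≤ √N` (`O(t √N log^t N)`); cut off the ends of `K ∩ {Ψ > 0}`
where some `ψ_i ≤ N^{1-κ}`, `κ = c ε/(log log N)^{t-1}` (`≤ t N^{1-κ}` points, weight `≤ log^t(2LN)`);
on the remaining interval `∏_i log ψ_i(n) = log^t N (1 + O(t κ + t log(2L)/log N))`, apply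
`PrimeCellsAbsolute` there, and use `A_1(N) log N / N = 1 + O(1/log N)` (de la Vallée Poussin, tree
`ChebyshevThetaDeLaValleePoussin_holds` + `Chebyshev.primeCounting_sub_theta_div_log_isBigO`) against
`sup ∏_p β_p ≤ C(t,L)(log log N)^{t-1}` (tree `stub_singularProduct_le_loglog_pow`); the template is the
route's proved `CellsToRelativeDimOne` (Theorems/LeeYangFibresCellsToRelativeDimOne). [cite: GreenTao2010, Conj. 1.2] -/
theorem stub_cellsToDimOne : PrimeCellsAbsolute → DimOne :=
  -- LANDED (p100021, wave 1; Aux p98865): `Theorems/LeeYangFibresAbsoluteUpgradeCellsToDimOne.lean` — the node shared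
  -- with the sibling line `dip-margin-rate-exchange` (same `PrimeCellsAbsolute`)
  Summit.Parity.GeneralizedHardyLittlewood.Theorems.AbsoluteUpgrade.stub_cellsToDimOne

/-! ## Composition (proved): the line closes the crux modulo its stubs -/

/-- **`AbsoluteUpgrade` from the seven stubs.**  `RelativeDimOne` (the crux's hypothesis) unlocks the two
guarded inputs; clipping gives absolute prime cells; partial summation gives `DimOne`. [folklore] -/
theorem AbsoluteUpgrade_of : AbsoluteUpgrade := by
  intro hR
  exact stub_cellsToDimOne
    (stub_clipCells (stub_cellParityLawLog3 hR) (stub_cellNLC hR) stub_singlesDecay stub_walshClipping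
      stub_roughAnatomy)

/-! ## Where the line stands (lead seat c3; everything below is LANDED and kernel-checked)

* The reduction is UNGUARDED: the two conjectural inputs give `DimOne` outright, so the crux's
  hypothesis `RelativeDimOne` is not used by the line (`dimOne_of_nlcInputs`, p119763).
* The cell-level node both mechanism lines deliver is the target itself:
  `PrimeCellsAbsolute ↔ DimOne` (p120846; `→` is the registered `stub_cellsToDimOne`, `←` the registered
  sub-goal `primeCellsAbsolute_of_dimOne`), hence the normal form
  `AbsoluteUpgrade ↔ (RelativeDimOne → PrimeCellsAbsolute)`.
So the stubs `stub_cellParityLawLog3 ∧ stub_cellNLC` are at least target-strength (they imply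
`DimOne` = stmt-Parity-0819), and promoting the shared node re-files the target: promote-stub material,
not a reshape. -/

example : CellParityLawLog3 → CellNLC → DimOne :=
  Summit.Parity.GeneralizedHardyLittlewood.Theorems.AbsoluteUpgrade.dimOne_of_nlcInputs

/-! The three normal-form theorems of `Theorems/LeeYangFibresAbsoluteUpgradeCellsOfDimOne.lean` (LANDED p120846, lead
seat c3; imported through `…AbsoluteUpgradeTarget` since seat c4): -/

example : PrimeCellsAbsolute ↔ DimOne :=
  Summit.Parity.GeneralizedHardyLittlewood.Theorems.AbsoluteUpgrade.primeCellsAbsolute_iff_dimOne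

example : AbsoluteUpgrade ↔ (RelativeDimOne → PrimeCellsAbsolute) :=
  Summit.Parity.GeneralizedHardyLittlewood.Theorems.AbsoluteUpgrade.absoluteUpgrade_iff_cells

example : (AbsoluteUpgrade ∧ RelativeDimOne) ↔ PrimeCellsAbsolute :=
  Summit.Parity.GeneralizedHardyLittlewood.Theorems.AbsoluteUpgrade.absoluteUpgrade_and_relativeDimOne_iff_cells

/-! ## Lead seat c4: the crux against the shared target's home declaration (LANDED p121721) -/

example : (AbsoluteUpgrade ∧ RelativeDimOne) ↔
    Summit.Parity.GeneralizedHardyLittlewood.Theses.DicksonFibration.DimOne :=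
  Summit.Parity.GeneralizedHardyLittlewood.Theorems.AbsoluteUpgrade.absoluteUpgrade_and_relativeDimOne_iff_target

example : AbsoluteUpgrade ↔
    (Summit.Parity.GeneralizedHardyLittlewood.Theses.DicksonFibration.DimOne ∨ ¬ RelativeDimOne) :=
  Summit.Parity.GeneralizedHardyLittlewood.Theorems.AbsoluteUpgrade.absoluteUpgrade_iff_target_or

example : CellParityLawLog3 → CellNLC →
    Summit.Parity.GeneralizedHardyLittlewood.Theses.DicksonFibration.DimOne :=
  Summit.Parity.GeneralizedHardyLittlewood.Theorems.AbsoluteUpgrade.target_of_nlcInputs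

/-- The discharge the day stmt-Parity-0819 lands (then `AbsoluteUpgrade_of` needs no stub at all). [folklore] -/
example (h : Summit.Parity.GeneralizedHardyLittlewood.Theses.DicksonFibration.DimOne) : AbsoluteUpgrade :=
  Summit.Parity.GeneralizedHardyLittlewood.Theorems.AbsoluteUpgrade.absoluteUpgrade_of_target h

/-! ## The mechanism at `t = 2`

The ideator's kernel-checked `t = 2` mechanism (`nlc_clips_mixed_amplitude`, `walshClipping_two`: the corner instances
`(2,1)∨(1,2)`, `(3,1)∨(2,2)` read `±4σσ'(θ₁₂ − θ₁θ₂) ≤ η + O(δ)`) is superseded by the landed all-`t` theorem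
`Theorems.AbsoluteUpgrade.stub_walshClipping` (single-coordinate corner swaps + Walsh inversion) and has been removed from
the skeleton; it remains in the crux workfile `Cruxes/AbsoluteUpgrade/SketchIdeator1.lean`. -/

end Summit.Parity.GeneralizedHardyLittlewood.Cruxes.AbsoluteUpgrade.NlcCellsAbsoluteClip

end
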